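import Mathlib
import HarnessLib
import Summits.NavierStokesRegularity.NavierStokesRegularity.Theorems.LocalHelicityTubeDoorFrobeniusProfileRigidityHeadMonotone
import Summits.NavierStokesRegularity.NavierStokesRegularity.Theorems.LocalSineTubeDoorEnstrophyProductionProfileRigidity

/-!
# Door S11 `LocalTubeDoorHelicity`, crux K2⁗ `FrobeniusProfileRigidity` (stmt-NavierStokesRegularity-19975) — the SHARP
# (dissipation-dominated) forms of the energy and enstrophy strata of the Type-I profile class

Cell ns-regularity-ideate, stub-worker `ns-helicity-19975-w1` under the K2⁗ lead nsreg-p6 (lands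
`--supports stmt-NavierStokesRegularity-19975 --as helper`; no claim).  The one-sided strata of
`…FrobeniusProfileRigidityHeadMonotone` (`v·∇H ≥ 0`, `v·∇p ≥ 0`) and of `…EnstrophyProductionSigned` (`ω·Sω ≤ 0`) use
the pointwise balances
  `∂ₜ|v|² − Δ|v|² = −2|Dv|²_F − 2 v·∇H`,  `∂ₜ|v|² + (v·∇)|v|² − Δ|v|² = −2|Dv|²_F − 2 v·∇p`,
  `∂ₜ|ω|² + (v·∇)|ω|² − Δ|ω|² = 2 ω·Sω − 2|Dω|²_F`
only through their SIGN, discarding the dissipation.  Keeping it gives the sharp statements, for a profile `v` of the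
door family's Type-I class (rate, continuity, unit-viscosity Oseen–Duhamel identity, divergence-free slices):

* `eq_zero_of_subcaloric_energy` / `eq_zero_of_driftSubcaloric_energy` — MASTER forms: if `|v|²` is a sub-solution of the
  heat equation (`∂ₜ|v|² ≤ Δ|v|²`), resp. of the drift–diffusion inequality (`∂ₜ|v|² + (v·∇)|v|² ≤ Δ|v|²`), pointwise
  on the open slab, then `v ≡ 0`;
* `eq_zero_of_headWork_le_dissipation` — **`−v·∇H ≤ |Dv|²_F` pointwise (head loss along streamlines never exceeds the
  local dissipation density; pressure-free `⟪v, ∂ₜv⟫ − ⟪v, Δv⟫ ≤ |Dv|²_F`) ⇒ `v ≡ 0`**;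
* `eq_zero_of_pressureWork_le_dissipation` — **`−v·∇p ≤ |Dv|²_F` pointwise (pressure work never exceeds dissipation;
  pressure-free `⟪v, ∂ₜv + (v·∇)v⟫ − ⟪v, Δv⟫ ≤ |Dv|²_F`) ⇒ `v ≡ 0`**;
* `curl_eq_zero_of_production_le_dissipation`, `eq_zero_of_production_le_dissipation` — **`ω·Sω ≤ |Dω|²_F` pointwise
  (enstrophy production never exceeds enstrophy dissipation) ⇒ `v ≡ 0`** — strictly more general than the signed
  stratum `ω·Sω ≤ 0` of `…EnstrophyProductionSigned.eq_zero_of_production_nonpos`.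

Contrapositive reading: a Type-I blow-up profile has, on every slab `(−∞, t₁)`, points where the pressure work (resp.
head loss, resp. vortex stretching) STRICTLY EXCEEDS the local dissipation — the sub-solution counterpart of the
hot-spot inequalities of the K2 programme (p472559, p483224), valid for every profile without passing to an extremal
element.  All by `le_of_bounded_subsolution` with the class rates; no window forms (inequalities do not spread).

WHAT THIS IS NOT: not a claim about Navier–Stokes regularity, not K2⁗ — sharp forms of settled dynamic strata of the
Type-I profile class (bears_on LADDER-NS N0, door S11 support).
-/

noncomputable section

-- the summit and its single sub-problem share the name (CONVENTIONS §1), as in every Theorems file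
set_option linter.dupNamespace false

namespace Summit.NavierStokesRegularity.NavierStokesRegularity.Theorems.LocalHelicityTubeDoorFrobeniusProfileRigidityDissipationDominated

open MeasureTheory Set Function Filter Topology TopologicalSpace Metric InnerProductSpace
open scoped RealInnerProductSpace InnerProductSpace Laplacian ContDiff
open Literature.Analysis Literature.Analysis.FluidPDE
open Summit.NavierStokesRegularity.NavierStokesRegularity.Theorems.LocalSineTubeDoorProfileAlignedWindowRigidityAncient
open Summit.NavierStokesRegularity.NavierStokesRegularity.Theorems.PoloidalWindowDoorPoloidalWindowRigidityWindow
open Summit.NavierStokesRegularity.NavierStokesRegularity.Theorems.PoloidalWindowDoorPoloidalWindowRigidityFlat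
open Summit.NavierStokesRegularity.NavierStokesRegularity.Theorems.PoloidalWindowDoorPoloidalWindowRigidityDegenerate
open Summit.NavierStokesRegularity.NavierStokesRegularity.Theorems.PoloidalWindowDoorPoloidalWindowRigidityClassRate
open Summit.NavierStokesRegularity.NavierStokesRegularity.Theorems.LocalSineTubeDoorBoundedSubsolutionMaxPrinciple
open Summit.NavierStokesRegularity.NavierStokesRegularity.Theorems.LocalSineTubeDoorEnstrophyProductionProfileRigidity
open Summit.NavierStokesRegularity.NavierStokesRegularity.Theorems.LocalHelicityTubeDoorFrobeniusProfileRigidityHeadMonotone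

variable {C : ℝ} {v : ℝ → EuclideanSpace ℝ (Fin 3) → EuclideanSpace ℝ (Fin 3)}

/-! ### master forms: sub-caloric kinetic energy density -/

/-- **SUB-CALORIC KINETIC ENERGY ⇒ TRIVIAL.**  If `∂ₜ|v|² ≤ Δ|v|²` pointwise on the open slab (two-sided time derivative
of `τ ↦ |v(τ,y)|²`), a profile of the Type-I class vanishes identically. -/
theorem eq_zero_of_subcaloric_energy (hrate : HasTypeITimeDecay C v)
    (hcont : ContinuousOn (uncurry v) (Iio (0 : ℝ) ×ˢ univ))
    (hmild : ∀ s t : ℝ, s < t → t < 0 → ∀ x,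
      v t x = UnboundedOperators.heatExtension (v s) (t - s) x - oseenDuhamel 1 s v v t x)
    (hdiv : ∀ t < 0, VectorCalculus.IsDivFree (v t))
    (hsub : ∀ s < 0, ∀ y,
      deriv (fun τ => ⟪v τ y, v τ y⟫_ℝ) s ≤ (Δ (fun y' => ⟪v s y', v s y'⟫_ℝ)) y) :
    ∀ t < 0, ∀ x, v t x = 0 := by
  refine eq_zero_of_normSq_subsolution hrate hcont hmild hdiv (b := fun _ _ => 0)
    (fun t₁ _ => ⟨0, fun t _ x => by simp⟩) fun t ht x => ?_
  obtain ⟨hq, -, -⟩ := hasDerivAt_normSq hrate hcont hmild hdiv ht x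
  refine ⟨hq, ?_⟩
  have h0 : fderiv ℝ (fun y => ⟪v t y, v t y⟫_ℝ) x ((fun (_ : ℝ) (_ : EuclideanSpace ℝ (Fin 3)) =>
      (0 : EuclideanSpace ℝ (Fin 3))) t x) = 0 := by simp
  rw [h0, add_zero]
  linarith [hsub t ht x]

/-- **DRIFT-SUB-CALORIC KINETIC ENERGY ⇒ TRIVIAL.**  If `∂ₜ|v|² + (v·∇)|v|² ≤ Δ|v|²` pointwise on the open slab, a
profile of the Type-I class vanishes identically (the drift `v` is bounded on every slab `t ≤ t₁ < 0` by the rate). -/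
theorem eq_zero_of_driftSubcaloric_energy (hrate : HasTypeITimeDecay C v)
    (hcont : ContinuousOn (uncurry v) (Iio (0 : ℝ) ×ˢ univ))
    (hmild : ∀ s t : ℝ, s < t → t < 0 → ∀ x,
      v t x = UnboundedOperators.heatExtension (v s) (t - s) x - oseenDuhamel 1 s v v t x)
    (hdiv : ∀ t < 0, VectorCalculus.IsDivFree (v t))
    (hsub : ∀ s < 0, ∀ y,
      deriv (fun τ => ⟪v τ y, v τ y⟫_ℝ) s + fderiv ℝ (fun y' => ⟪v s y', v s y'⟫_ℝ) y (v s y) ≤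
        (Δ (fun y' => ⟪v s y', v s y'⟫_ℝ)) y) :
    ∀ t < 0, ∀ x, v t x = 0 := by
  refine eq_zero_of_normSq_subsolution hrate hcont hmild hdiv (b := v) (fun t₁ ht₁ => ?_) fun t ht x => ?_
  · obtain ⟨B, hB⟩ := bdd_of_hasTypeITimeDecay hrate (-t₁ / 2) (by linarith)
    exact ⟨B, fun t ht x => hB t (by linarith) x⟩
  · obtain ⟨hq, -, -⟩ := hasDerivAt_normSq hrate hcont hmild hdiv ht x
    exact ⟨hq, by linarith [hsub t ht x]⟩

/-! ### dissipation-dominated head loss / pressure work -/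

/-- **HEAD LOSS DOMINATED BY DISSIPATION ⇒ TRIVIAL.**  If `⟪v, ∂ₜv⟫ − ⟪v, Δv⟫ ≤ |Dv|²_F` pointwise on the open slab —
for any classical pressure this reads `−v·∇(p + |v|²/2) ≤ |Dv|²_F`: the loss of Bernoulli head along streamlines never
exceeds the local dissipation density — then a profile of the Type-I class vanishes identically.  (Contains the
Bernoulli stratum `v·∇H = 0` and the one-sided stratum `v·∇H ≥ 0`.) -/
theorem eq_zero_of_headWork_le_dissipation (hrate : HasTypeITimeDecay C v)
    (hcont : ContinuousOn (uncurry v) (Iio (0 : ℝ) ×ˢ univ))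
    (hmild : ∀ s t : ℝ, s < t → t < 0 → ∀ x,
      v t x = UnboundedOperators.heatExtension (v s) (t - s) x - oseenDuhamel 1 s v v t x)
    (hdiv : ∀ t < 0, VectorCalculus.IsDivFree (v t))
    (hle : ∀ s < 0, ∀ y,
      ⟪v s y, deriv (fun τ => v τ y) s⟫_ℝ - ⟪v s y, (Δ (v s)) y⟫_ℝ ≤ frobeniusNormSq (fderiv ℝ (v s) y)) :
    ∀ t < 0, ∀ x, v t x = 0 := by
  refine eq_zero_of_subcaloric_energy hrate hcont hmild hdiv fun s hs y => ?_
  obtain ⟨-, hderiv, hL⟩ := hasDerivAt_normSq hrate hcont hmild hdiv hs y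
  rw [hderiv, hL, real_inner_comm (v s y)]
  linarith [hle s hs y]

/-- **PRESSURE WORK DOMINATED BY DISSIPATION ⇒ TRIVIAL.**  If `⟪v, ∂ₜv + (v·∇)v⟫ − ⟪v, Δv⟫ ≤ |Dv|²_F` pointwise on
the open slab — for any classical pressure this reads `−v·∇p ≤ |Dv|²_F`: the pressure work on a fluid particle never
exceeds the local dissipation density — then a profile of the Type-I class vanishes identically.  (Contains the
adverse-pressure stratum `v·∇p ≥ 0` and the affine-pressure stratum.) -/
theorem eq_zero_of_pressureWork_le_dissipation (hrate : HasTypeITimeDecay C v)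
    (hcont : ContinuousOn (uncurry v) (Iio (0 : ℝ) ×ˢ univ))
    (hmild : ∀ s t : ℝ, s < t → t < 0 → ∀ x,
      v t x = UnboundedOperators.heatExtension (v s) (t - s) x - oseenDuhamel 1 s v v t x)
    (hdiv : ∀ t < 0, VectorCalculus.IsDivFree (v t))
    (hle : ∀ s < 0, ∀ y,
      ⟪v s y, deriv (fun τ => v τ y) s + convect (v s) (v s) y⟫_ℝ - ⟪v s y, (Δ (v s)) y⟫_ℝ ≤
        frobeniusNormSq (fderiv ℝ (v s) y)) :
    ∀ t < 0, ∀ x, v t x = 0 := by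
  have hA : IsTypeIAncientMild C v := isTypeIAncientMild_of_class hrate hcont hmild hdiv
  have hsm : IsSmoothSpaceTimeOn (Iio 0) v := hA.contDiffOn
  refine eq_zero_of_driftSubcaloric_energy hrate hcont hmild hdiv fun s hs y => ?_
  obtain ⟨-, hderiv, hL⟩ := hasDerivAt_normSq hrate hcont hmild hdiv hs y
  have hVd : DifferentiableAt ℝ (v s) y := ((hsm.contDiff_slice hs).differentiable (by simp)) y
  have hX : fderiv ℝ (fun y' => ⟪v s y', v s y'⟫_ℝ) y (v s y) = 2 * ⟪v s y, convect (v s) (v s) y⟫_ℝ := by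
    rw [fderiv_inner_apply ℝ hVd hVd (v s y), convect_apply, real_inner_comm (v s y), two_mul]
  rw [hderiv, hX, hL, real_inner_comm (v s y)]
  have h2 := hle s hs y
  rw [inner_add_right] at h2
  linarith

/-- **Pressure form of the last statement**: `−⟪v, ∇p⟫ ≤ |Dv|²_F` on every slice for some classical pressure on a
window ⇒ `v ≡ 0`. -/
theorem eq_zero_of_pressureWork_le_dissipation_pressure (hrate : HasTypeITimeDecay C v)
    (hcont : ContinuousOn (uncurry v) (Iio (0 : ℝ) ×ˢ univ))
    (hmild : ∀ s t : ℝ, s < t → t < 0 → ∀ x,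
      v t x = UnboundedOperators.heatExtension (v s) (t - s) x - oseenDuhamel 1 s v v t x)
    (hdiv : ∀ t < 0, VectorCalculus.IsDivFree (v t))
    (hp : ∀ s < 0, ∃ t₀ < s, ∃ p : ℝ → EuclideanSpace ℝ (Fin 3) → ℝ,
      IsClassicalNSSolutionOn (Ioo t₀ 0) 1 0 v p ∧
        ∀ y, -⟪v s y, gradient (p s) y⟫_ℝ ≤ frobeniusNormSq (fderiv ℝ (v s) y)) :
    ∀ t < 0, ∀ x, v t x = 0 := by
  refine eq_zero_of_pressureWork_le_dissipation hrate hcont hmild hdiv fun s hs y => ?_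
  obtain ⟨t₀, ht₀, p, hcl, hh⟩ := hp s hs
  have hsI : s ∈ Ioo t₀ 0 := ⟨ht₀, hs⟩
  have hM := hcl.momentum s hsI y
  rw [timeDerivWithin_apply, derivWithin_of_isOpen isOpen_Ioo hsI] at hM
  have h := congrArg (fun z => ⟪v s y, z⟫_ℝ) hM
  simp only [inner_add_right, inner_sub_right, one_smul, Pi.zero_apply, add_zero] at h
  rw [inner_add_right]
  linarith [hh y]

/-- **Not backward-singular, dissipation-dominated pressure work.** -/
theorem not_backwardSingular_of_pressureWork_le_dissipation (hrate : HasTypeITimeDecay C v)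
    (hcont : ContinuousOn (uncurry v) (Iio (0 : ℝ) ×ˢ univ))
    (hmild : ∀ s t : ℝ, s < t → t < 0 → ∀ x,
      v t x = UnboundedOperators.heatExtension (v s) (t - s) x - oseenDuhamel 1 s v v t x)
    (hdiv : ∀ t < 0, VectorCalculus.IsDivFree (v t))
    (hle : ∀ s < 0, ∀ y,
      ⟪v s y, deriv (fun τ => v τ y) s + convect (v s) (v s) y⟫_ℝ - ⟪v s y, (Δ (v s)) y⟫_ℝ ≤
        frobeniusNormSq (fderiv ℝ (v s) y)) :
    ¬ IsBackwardSingularPoint v 0 :=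
  not_backwardSingular_of_zero (eq_zero_of_pressureWork_le_dissipation hrate hcont hmild hdiv hle)

/-! ### dissipation-dominated enstrophy production -/

/-- **ENSTROPHY PRODUCTION DOMINATED BY ENSTROPHY DISSIPATION ⇒ IRROTATIONAL.**  If `⟪ω, Dv ω⟫ ≤ |Dω|²_F` pointwise on
every slice (`ω = curl v`), the enstrophy density `|ω|²` of a profile of the Type-I class is a bounded sub-solution of
`∂ₜq + (v·∇)q − Δq ≤ 0` on every slab `[t₀, t₁] × ℝ³`, `t₁ < 0` (balance `enstrophyDensity_balance`), hence
`|ω(t₁,x)|² ≤ (C₂/(−t₀))² → 0` by the whole-space maximum principle and the class vorticity rate. -/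
theorem curl_eq_zero_of_production_le_dissipation (hrate : HasTypeITimeDecay C v)
    (hcont : ContinuousOn (uncurry v) (Iio (0 : ℝ) ×ˢ univ))
    (hmild : ∀ s t : ℝ, s < t → t < 0 → ∀ x,
      v t x = UnboundedOperators.heatExtension (v s) (t - s) x - oseenDuhamel 1 s v v t x)
    (hdiv : ∀ t < 0, VectorCalculus.IsDivFree (v t))
    (hprod : ∀ s < 0, ∀ y, ⟪curl (v s) y, fderiv ℝ (v s) y (curl (v s) y)⟫_ℝ ≤
      frobeniusNormSq (fderiv ℝ (curl (v s)) y)) :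
    ∀ t < 0, ∀ x, curl (v t) x = 0 := by
  have hA : IsTypeIAncientMild C v := isTypeIAncientMild_of_class hrate hcont hmild hdiv
  obtain ⟨C₂, hC₂⟩ := exists_curl_rate_of_class hrate hcont hmild
  have hC₂0 : 0 ≤ C₂ := by
    have h := hC₂ (-1) (by norm_num) 0
    rw [neg_neg, div_one] at h
    exact (norm_nonneg _).trans h
  -- the sub-solution property at every point of the open slab
  have hsub : ∀ t < 0, ∀ x,
      HasDerivAt (fun τ => ⟪curl (v τ) x, curl (v τ) x⟫_ℝ) (deriv (fun τ => ⟪curl (v τ) x, curl (v τ) x⟫_ℝ) t) t ∧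
        deriv (fun τ => ⟪curl (v τ) x, curl (v τ) x⟫_ℝ) t +
            fderiv ℝ (fun y => ⟪curl (v t) y, curl (v t) y⟫_ℝ) x (v t x) -
            (Δ (fun y => ⟪curl (v t) y, curl (v t) y⟫_ℝ)) x ≤ 0 := by
    intro t ht x
    have ht₀ : t - 1 < 0 := by linarith
    have htI : t ∈ Ioo (t - 1) 0 := ⟨by linarith, ht⟩
    obtain ⟨p, hcl⟩ := hA.exists_isClassicalNSSolutionOn_Ioo ht₀
    have hbal := enstrophyDensity_balance isOpen_Ioo hcl htI x
    have hdω : HasDerivWithinAt (fun τ => vorticity v τ x) (timeDerivWithin (Ioo (t - 1) 0) (vorticity v) t x)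
        (Ioo (t - 1) 0) t := by
      rw [timeDerivWithin_apply]
      exact ((hcl.smooth_velocity.isSmoothSpaceTimeOn_vorticity isOpen_Ioo.uniqueDiffOn).differentiableWithinAt_time
        htI x).hasDerivWithinAt
    have hq : HasDerivAt (fun τ => ⟪curl (v τ) x, curl (v τ) x⟫_ℝ)
        (⟪vorticity v t x, timeDerivWithin (Ioo (t - 1) 0) (vorticity v) t x⟫_ℝ +
          ⟪timeDerivWithin (Ioo (t - 1) 0) (vorticity v) t x, vorticity v t x⟫_ℝ) t := by
      have h := (hdω.inner ℝ hdω).hasDerivAt (isOpen_Ioo.mem_nhds htI)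
      simpa only [vorticity_apply] using h
    refine ⟨hq.differentiableAt.hasDerivAt, ?_⟩
    have hderiv : deriv (fun τ => ⟪curl (v τ) x, curl (v τ) x⟫_ℝ) t =
        timeDerivWithin (Ioo (t - 1) 0) (fun τ y => ⟪curl (v τ) y, curl (v τ) y⟫_ℝ) t x := by
      rw [timeDerivWithin_apply, derivWithin_of_isOpen isOpen_Ioo htI]
    rw [hderiv]
    have h1 : (1 : ℝ) * (Δ (fun y => ⟪curl (v t) y, curl (v t) y⟫_ℝ)) x =
        (Δ (fun y => ⟪curl (v t) y, curl (v t) y⟫_ℝ)) x := one_mul _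
    rw [← h1, hbal]
    have := hprod t ht x
    linarith
  -- the maximum principle on `[t₀, t₁] × ℝ³`, then `t₀ → −∞`
  set q : ℝ → EuclideanSpace ℝ (Fin 3) → ℝ := fun τ y => ⟪curl (v τ) y, curl (v τ) y⟫_ℝ with hqdef
  set qt : ℝ → EuclideanSpace ℝ (Fin 3) → ℝ := fun τ y => deriv (fun τ' => q τ' y) τ with hqtdef
  have hsmω : IsSmoothSpaceTimeOn (Iio 0) (vorticity v) :=
    (show IsSmoothSpaceTimeOn (Iio 0) v from hA.contDiffOn).isSmoothSpaceTimeOn_vorticity isOpen_Iio.uniqueDiffOn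
  intro t₁ ht₁ x₁
  have hkey : ∀ t₀ < t₁, q t₁ x₁ ≤ (C₂ / (-t₀)) ^ 2 := by
    intro t₀ ht₀
    obtain ⟨B, hB⟩ := bdd_of_hasTypeITimeDecay hrate (-t₁ / 2) (by linarith)
    have hbA : ∀ t ∈ Icc t₀ t₁, ∀ x, ‖v t x‖ ≤ B := fun t ht x => hB t (by linarith [ht.2]) x
    have hq_c : ContinuousOn (uncurry q) (Icc t₀ t₁ ×ˢ univ) := by
      have hωc : ContinuousOn (uncurry (vorticity v)) (Icc t₀ t₁ ×ˢ univ) :=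
        hsmω.continuousOn.mono (prod_mono (fun t ht => lt_of_le_of_lt ht.2 ht₁) Subset.rfl)
      have h : ContinuousOn (fun z => ⟪uncurry (vorticity v) z, uncurry (vorticity v) z⟫_ℝ) (Icc t₀ t₁ ×ˢ univ) :=
        hωc.inner hωc
      refine h.congr fun z _ => ?_
      simp only [hqdef, uncurry, vorticity_apply]
    have hq2 : ∀ t ∈ Icc t₀ t₁, ContDiff ℝ 2 (q t) := fun t ht => by
      have htn : t < 0 := lt_of_le_of_lt ht.2 ht₁
      have hΩ : ContDiff ℝ 2 (curl (v t)) :=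
        contDiff_curl (n := 2) (analyticOnNhd_slice hcont (bdd_of_hasTypeITimeDecay hrate) hmild htn).contDiff
      exact hΩ.inner ℝ hΩ
    have hqt : ∀ x, ∀ t ∈ Icc t₀ t₁, HasDerivAt (fun τ => q τ x) (qt t x) t :=
      fun x t ht => (hsub t (lt_of_le_of_lt ht.2 ht₁) x).1
    have hlaw : ∀ t ∈ Icc t₀ t₁, ∀ x, qt t x + fderiv ℝ (q t) x (v t x) - (Δ (q t)) x ≤ 0 :=
      fun t ht x => (hsub t (lt_of_le_of_lt ht.2 ht₁) x).2
    have hqbd : ∀ t < 0, ∀ x, q t x ≤ (C₂ / (-t)) ^ 2 := fun t ht x => by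
      simp only [hqdef, real_inner_self_eq_norm_sq]
      exact pow_le_pow_left₀ (norm_nonneg _) (hC₂ t ht x) 2
    have hbdd : ∀ t ∈ Icc t₀ t₁, ∀ x, |q t x| ≤ (C₂ / (-t₁)) ^ 2 := fun t ht x => by
      have htn : t < 0 := lt_of_le_of_lt ht.2 ht₁
      have hq0 : 0 ≤ q t x := by simp only [hqdef]; exact real_inner_self_nonneg
      rw [abs_of_nonneg hq0]
      refine (hqbd t htn x).trans ?_
      have h1 : C₂ / (-t) ≤ C₂ / (-t₁) := div_le_div_of_nonneg_left hC₂0 (by linarith) (by linarith [ht.2])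
      exact pow_le_pow_left₀ (div_nonneg hC₂0 (by linarith)) h1 2
    have hinit : ∀ x, q t₀ x ≤ (C₂ / (-t₀)) ^ 2 := fun x => hqbd t₀ (ht₀.trans ht₁) x
    exact le_of_bounded_subsolution ht₀ hbA hq_c hq2 hqt hlaw hbdd hinit t₁ ⟨ht₀.le, le_rfl⟩ x₁
  have hq0 : 0 ≤ q t₁ x₁ := by simp only [hqdef]; exact real_inner_self_nonneg
  have hqle : q t₁ x₁ ≤ 0 := by
    refine le_of_forall_pos_le_add fun η hη => ?_
    set t₀ : ℝ := t₁ - 1 - C₂ / Real.sqrt η with ht₀def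
    have hsη : 0 < Real.sqrt η := Real.sqrt_pos.2 hη
    have hq' : 0 ≤ C₂ / Real.sqrt η := div_nonneg hC₂0 hsη.le
    have ht₀ : t₀ < t₁ := by rw [ht₀def]; linarith
    have hnt₀ : C₂ / Real.sqrt η ≤ -t₀ := by rw [ht₀def]; linarith
    have hpos : 0 < -t₀ := by linarith
    have h1 : C₂ / (-t₀) ≤ Real.sqrt η := by
      rw [div_le_iff₀ hpos]
      calc C₂ = C₂ / Real.sqrt η * Real.sqrt η := by field_simp
        _ ≤ -t₀ * Real.sqrt η := mul_le_mul_of_nonneg_right hnt₀ hsη.le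
        _ = Real.sqrt η * -t₀ := mul_comm _ _
    have h2 : (C₂ / (-t₀)) ^ 2 ≤ Real.sqrt η ^ 2 := pow_le_pow_left₀ (div_nonneg hC₂0 hpos.le) h1 2
    rw [Real.sq_sqrt hη.le] at h2
    linarith [hkey t₀ ht₀]
  have hq00 : q t₁ x₁ = 0 := le_antisymm hqle hq0
  simpa only [hqdef, inner_self_eq_zero] using hq00

/-- **ENSTROPHY PRODUCTION DOMINATED BY ENSTROPHY DISSIPATION ⇒ TRIVIAL** (`ω·Sω ≤ |Dω|²_F` pointwise on every slice ⇒
`v ≡ 0`; sharpens `…EnstrophyProductionSigned.eq_zero_of_production_nonpos`). -/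
theorem eq_zero_of_production_le_dissipation (hrate : HasTypeITimeDecay C v)
    (hcont : ContinuousOn (uncurry v) (Iio (0 : ℝ) ×ˢ univ))
    (hmild : ∀ s t : ℝ, s < t → t < 0 → ∀ x,
      v t x = UnboundedOperators.heatExtension (v s) (t - s) x - oseenDuhamel 1 s v v t x)
    (hdiv : ∀ t < 0, VectorCalculus.IsDivFree (v t))
    (hprod : ∀ s < 0, ∀ y, ⟪curl (v s) y, fderiv ℝ (v s) y (curl (v s) y)⟫_ℝ ≤
      frobeniusNormSq (fderiv ℝ (curl (v s)) y)) :
    ∀ t < 0, ∀ x, v t x = 0 :=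
  eq_zero_of_irrotational hrate hcont hmild hdiv
    (curl_eq_zero_of_production_le_dissipation hrate hcont hmild hdiv hprod)

/-- **Not backward-singular, dissipation-dominated production.**  Contrapositive: a Type-I blow-up profile stretches
vorticity FASTER than it dissipates enstrophy, `ω·Sω > |Dω|²_F`, somewhere on every slab `(−∞, t₁)`. -/
theorem not_backwardSingular_of_production_le_dissipation (hrate : HasTypeITimeDecay C v)
    (hcont : ContinuousOn (uncurry v) (Iio (0 : ℝ) ×ˢ univ))
    (hmild : ∀ s t : ℝ, s < t → t < 0 → ∀ x,
      v t x = UnboundedOperators.heatExtension (v s) (t - s) x - oseenDuhamel 1 s v v t x)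
    (hdiv : ∀ t < 0, VectorCalculus.IsDivFree (v t))
    (hprod : ∀ s < 0, ∀ y, ⟪curl (v s) y, fderiv ℝ (v s) y (curl (v s) y)⟫_ℝ ≤
      frobeniusNormSq (fderiv ℝ (curl (v s)) y)) :
    ¬ IsBackwardSingularPoint v 0 :=
  not_backwardSingular_of_zero (eq_zero_of_production_le_dissipation hrate hcont hmild hdiv hprod)

end Summit.NavierStokesRegularity.NavierStokesRegularity.Theorems.LocalHelicityTubeDoorFrobeniusProfileRigidityDissipationDominated

end
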